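import Literature.Barriers.SmoothPoincare4.SmallExoticaFrontierProofs
import Literature.Topology.FourManifolds.HCobordismWallParity
import Literature.Barriers.SmoothPoincare4.HCobordismTheoremFails
import HarnessLib

/-!
# Akhmedov–Park at `b₂ = 3` needs only the ODD case of Wall's Thm. 2, which the tree proves
# modulo Kirby's Thm. X.2 and Thom's theorem

`SmallExoticaFrontierProofs.lean` assembles `akhmedovPark2010_exotic_bTwo_three` (and the barrier
`SmallExoticaBarrier`) from three named facts: Wall 1964 Thm. 2
(`Literature.Topology.FourManifolds.isHCobordant_of_equivalent_intersectionForm`: isometric forms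
⇒ h-cobordant), Freedman's h-cobordism theorem
(`Literature.Topology.FourManifolds.nonempty_homeomorph_of_isHCobordant_four`) and the
Seiberg–Witten leaf `akhmedovPark2010_lemma8_family`.  Wall's theorem enters only through step
(c), for pairs of manifolds whose forms are isometric to `I₊ ⊕ 2I₋` — an ODD form
(`isOdd_intersectionForm_of_equivalent_stdOddFormOneTwo`).

For odd forms Wall's Thm. 2 is a THEOREM of the tree modulo two named facts, both stated
elsewhere with their own discharge routes — Kirby's Thm. X.2 = Wall 1964a Thm. 2
(`Literature.Topology.FourManifolds.exists_diffeomorph_freeCohomologyMap_eq_of_isometryEquiv`) and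
Thom's `Ω₄^SO ≅ ℤ` (`Literature.Topology.FourManifolds.isOrientedBordant_of_signature_eq`):
`Literature.Topology.FourManifolds.isHCobordant_of_equivalent_intersectionForm_of_not_isEven`
(`HCobordismWallParity.lean`; Kirby's proof of Thm. X.1, pp. 55–56, non-spin case).  The even case
of Wall's theorem needs in addition the spin bordism step of Kirby p. 55 (`Ω₄^spin → ℤ` injective,
Cor. IX.3), which has no tree statement.  This file re-threads step (c) and the assembly through
the odd case, so that the Akhmedov–Park fact and the small-exotica barrier rest on X.2, Thom,
Freedman and the Seiberg–Witten leaf, and no longer on the even (spin) half of Wall's theorem: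

* `nonempty_homeomorph_of_equivalent_stdOddFormOneTwo_of_thmX2_of_thom` — step (c);
* `akhmedovPark2010_exotic_bTwo_three_of_thmX2_of_thom_of_freedman` — the target;
* `smallExoticaBarrier_of_thmX2_of_thom_of_freedman_of_lemma8` — the barrier;
* `exists_isHCobordant_isEmpty_diffeomorph_four_of_thmX2_of_thom_of_lemma8`,
  `hCobordismBarrierFour_of_thmX2_of_thom_of_lemma8` — Donaldson's counterexample statement
  (`Literature.Topology.FourManifolds.exists_isHCobordant_isEmpty_diffeomorph_four`: an h-cobordant
  non-diffeomorphic simply connected pair) and the h-cobordism barrier `HCobordismBarrierFour`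
  (`HCobordismTheoremFails.lean`) from X.2, Thom and the Seiberg–Witten leaf alone — here not even
  Freedman's theorem is needed, the pair `X 0`, `X 1` being h-cobordant by the odd case directly.

## References

* [AkhmedovPark2010] A. Akhmedov, B. D. Park, *Exotic smooth structures on small 4-manifolds with
  odd signatures*, Invent. Math. 181 (2010), Thm. 1 (i), Lemma 8 and its proof (step (c)).
* [WallJLMS1964] C. T. C. Wall, *On simply-connected 4-manifolds*, J. London Math. Soc. 39
  (1964), Thm. 2.
* [Kirby1989] R. C. Kirby, *The topology of 4-manifolds*, LNM 1374 (1989), Ch. X, Thms. 1–2 and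
  the proof of Thm. 1, pp. 55–56 (non-spin case).
* [FreedmanJDG1982] M. H. Freedman, *The topology of four-dimensional manifolds*, J. Differential
  Geom. 17 (1982), Thm. 1.3.
-/

noncomputable section

open scoped Manifold ContDiff
open CategoryTheory LinearMap.BilinForm

namespace Literature.Barriers.SmoothPoincare4

/-- Local notation: `𝔼 n` is the model Euclidean space `EuclideanSpace ℝ (Fin n)`. -/
local notation "𝔼 " n:arg => EuclideanSpace ℝ (Fin n)

/-- Local notation: `Q⟦μ⟧` is the intersection form on `H²(M; ℤ)/T` of the closed `ℤ`-oriented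
topological 4-manifold `(M, μ)` (as in `SmallExoticaFrontierProofs.lean`). -/
local notation "Q⟦" μ "⟧" =>
  Literature.AlgebraicTopology.SingularHomology.intersectionForm two_add_two_eq_four μ

/-- **Step (c) of Akhmedov–Park's proof of Lemma 8 through the odd case of Wall's Thm. 2**: GIVEN
Kirby's Thm. X.2 (`h1`), Thom's theorem (`h2`) and Freedman's h-cobordism theorem (`hF`), two
simply connected closed smooth 4-manifolds whose intersection forms are both isometric to
`I₊ ⊕ 2I₋` are homeomorphic: the forms are isometric to each other and odd
(`isOdd_intersectionForm_of_equivalent_stdOddFormOneTwo`), so the manifolds are h-cobordant by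
`Literature.Topology.FourManifolds.isHCobordant_of_equivalent_intersectionForm_of_not_isEven`
(Wall's Thm. 2, odd case, proved modulo `h1`, `h2`) and homeomorphic by `hF`.
[cite: AkhmedovPark2010, proof of Lemma 8] [cite: WallJLMS1964, Thm. 2]
[cite: Kirby1989, Ch. X, proof of Thm. 1, pp. 55–56] [cite: FreedmanJDG1982, Thm. 1.3] -/
theorem nonempty_homeomorph_of_equivalent_stdOddFormOneTwo_of_thmX2_of_thom
    (h1 : Literature.Topology.FourManifolds.exists_diffeomorph_freeCohomologyMap_eq_of_isometryEquiv)
    (h2 : Literature.Topology.FourManifolds.isOrientedBordant_of_signature_eq.{0})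
    (hF : Literature.Topology.FourManifolds.nonempty_homeomorph_of_isHCobordant_four.{0})
    (M N : Type) [TopologicalSpace M] [T2Space M] [SecondCountableTopology M]
    [ChartedSpace (𝔼 4) M] [IsManifold (𝓡 4) ∞ M] [CompactSpace M] [SimplyConnectedSpace M]
    [TopologicalSpace N] [T2Space N] [SecondCountableTopology N] [ChartedSpace (𝔼 4) N]
    [IsManifold (𝓡 4) ∞ N] [CompactSpace N] [SimplyConnectedSpace N]
    (μ : Literature.AlgebraicTopology.SingularHomology.HomologicalOrientation ℤ M 4)
    (ν : Literature.AlgebraicTopology.SingularHomology.HomologicalOrientation ℤ N 4)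
    (hμ : (Q⟦μ⟧).Equivalent stdOddFormOneTwo) (hν : (Q⟦ν⟧).Equivalent stdOddFormOneTwo) :
    Nonempty (M ≃ₜ N) :=
  hF (Literature.Topology.FourManifolds.isHCobordant_of_equivalent_intersectionForm_of_not_isEven
    h1 h2 μ ν (hμ.trans hν.symm) (isOdd_intersectionForm_of_equivalent_stdOddFormOneTwo μ hμ))

/-- **Akhmedov–Park 2010, Thm. 1 (i), `m = 2` (`akhmedovPark2010_exotic_bTwo_three`) from Kirby's
Thm. X.2, Thom's theorem, Freedman's h-cobordism theorem and the Seiberg–Witten leaf** — the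
assembly `akhmedovPark2010_exotic_bTwo_three_of_wallThmTwo_of_freedman` with Wall's Thm. 2
replaced by its odd case, proved in the tree modulo `h1`, `h2`: take `M := X 0`, `N := X`; each
`X i` is homeomorphic to `X 0` by `nonempty_homeomorph_of_equivalent_stdOddFormOneTwo_of_thmX2_of_thom`.
[cite: AkhmedovPark2010, Thm. 1 (i) and Lemma 8] -/
theorem akhmedovPark2010_exotic_bTwo_three_of_thmX2_of_thom_of_freedman
    (h1 : Literature.Topology.FourManifolds.exists_diffeomorph_freeCohomologyMap_eq_of_isometryEquiv)
    (h2 : Literature.Topology.FourManifolds.isOrientedBordant_of_signature_eq.{0})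
    (hF : Literature.Topology.FourManifolds.nonempty_homeomorph_of_isHCobordant_four.{0})
    (h8 : akhmedovPark2010_lemma8_family) : akhmedovPark2010_exotic_bTwo_three := by
  obtain ⟨X, i₁, i₂, i₃, i₄, i₅, i₆, i₇, μ, hQ, hH, hinj⟩ := h8
  exact ⟨X 0, i₁ 0, i₂ 0, i₃ 0, i₄ 0, i₅ 0, i₆ 0, i₇ 0, X, i₁, i₂, i₃, i₄, i₅, i₆, hH 0,
    fun i => nonempty_homeomorph_of_equivalent_stdOddFormOneTwo_of_thmX2_of_thom h1 h2 hF
      (X i) (X 0) (μ i) (μ 0) (hQ i) (hQ 0), hinj⟩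

/-- **The small-exotica barrier (`SmallExoticaBarrier`: `b₂`-graded rigidity fails at `b₂ = 3`)
from Kirby's Thm. X.2, Thom's theorem, Freedman's h-cobordism theorem and the Seiberg–Witten
leaf** (through `smallExoticaBarrier_of_akhmedovPark`). [cite: AkhmedovPark2010, Thm. 1 (i)] -/
theorem smallExoticaBarrier_of_thmX2_of_thom_of_freedman_of_lemma8
    (h1 : Literature.Topology.FourManifolds.exists_diffeomorph_freeCohomologyMap_eq_of_isometryEquiv)
    (h2 : Literature.Topology.FourManifolds.isOrientedBordant_of_signature_eq.{0})
    (hF : Literature.Topology.FourManifolds.nonempty_homeomorph_of_isHCobordant_four.{0})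
    (h8 : akhmedovPark2010_lemma8_family) : SmallExoticaBarrier :=
  smallExoticaBarrier_of_akhmedovPark
    (akhmedovPark2010_exotic_bTwo_three_of_thmX2_of_thom_of_freedman h1 h2 hF h8)

/-! ### Donaldson's counterexample statement and the h-cobordism barrier, without Freedman -/

/-- **An h-cobordant, non-diffeomorphic pair of simply connected closed smooth 4-manifolds
(`Literature.Topology.FourManifolds.exists_isHCobordant_isEmpty_diffeomorph_four`, Donaldson's
counterexample in existence form) from Kirby's Thm. X.2, Thom's theorem and the Seiberg–Witten
leaf alone** — no Freedman: the members `X 0`, `X 1` of Akhmedov–Park's family have isometric ODD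
forms (both `≅ I₊ ⊕ 2I₋`), hence are h-cobordant by the odd case of Wall's Thm. 2
(`Literature.Topology.FourManifolds.isHCobordant_of_equivalent_intersectionForm_of_not_isEven`),
and are not diffeomorphic by the leaf.  (Donaldson's own inference, p. 142, for his pair
`Z`, `ℂP² # 9ℂP²bar`, whose forms `⟨1⟩ ⊕ 9⟨−1⟩` are odd as well.)
[cite: DonaldsonIrrationality1987, p. 142] [cite: AkhmedovPark2010, Lemma 8] [cite: WallJLMS1964, Thm. 2] -/
theorem exists_isHCobordant_isEmpty_diffeomorph_four_of_thmX2_of_thom_of_lemma8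
    (h1 : Literature.Topology.FourManifolds.exists_diffeomorph_freeCohomologyMap_eq_of_isometryEquiv)
    (h2 : Literature.Topology.FourManifolds.isOrientedBordant_of_signature_eq.{0})
    (h8 : akhmedovPark2010_lemma8_family) :
    Literature.Topology.FourManifolds.exists_isHCobordant_isEmpty_diffeomorph_four := by
  obtain ⟨X, i₁, i₂, i₃, i₄, i₅, i₆, i₇, μ, hQ, _, hinj⟩ := h8
  refine ⟨X 0, X 1, i₁ 0, i₂ 0, i₃ 0, i₄ 0, i₅ 0, i₆ 0, i₇ 0, i₁ 1, i₂ 1, i₃ 1, i₄ 1, i₅ 1,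
    i₆ 1, i₇ 1,
    Literature.Topology.FourManifolds.isHCobordant_of_equivalent_intersectionForm_of_not_isEven
      h1 h2 (μ 0) (μ 1) ((hQ 0).trans (hQ 1).symm)
      (isOdd_intersectionForm_of_equivalent_stdOddFormOneTwo (μ 0) (hQ 0)),
    ⟨fun d => ?_⟩⟩
  exact absurd (hinj 0 1 ⟨d⟩) zero_ne_one

/-- **The h-cobordism barrier in dimension 4 (`HCobordismBarrierFour`) from Kirby's Thm. X.2,
Thom's theorem and the Seiberg–Witten leaf** (through `hCobordismBarrierFour_of_donaldson`), again
without Freedman and without the even half of Wall's theorem.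
[cite: DonaldsonIrrationality1987, p. 142] [cite: AkhmedovPark2010, Lemma 8] -/
theorem hCobordismBarrierFour_of_thmX2_of_thom_of_lemma8
    (h1 : Literature.Topology.FourManifolds.exists_diffeomorph_freeCohomologyMap_eq_of_isometryEquiv)
    (h2 : Literature.Topology.FourManifolds.isOrientedBordant_of_signature_eq.{0})
    (h8 : akhmedovPark2010_lemma8_family) : HCobordismBarrierFour :=
  hCobordismBarrierFour_of_donaldson
    (exists_isHCobordant_isEmpty_diffeomorph_four_of_thmX2_of_thom_of_lemma8 h1 h2 h8)

end Literature.Barriers.SmoothPoincare4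

end
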